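import Literature.IUT.HodgeTheaters.PiAvatarBaseKitOfTorsionMonodromy
import HarnessLib

/-!
# The bad-pair binder TYPE `BadPairAt v` is INHABITED at the genuine initial Θ-data — two profinite STAND-INS, and the
# [IUTchI] §6 base kit at the `X̲→`-stand-in with binders {`CG`, `hS`, `M`, `hA`, `hI`, sign law} only
# ([IUTchI] Def 3.1 (e)(f), Def 6.1; defs + lemmas — post-freeze additive D13 / flip-ledger row «BadPairAt-NV», not a cone member)

S. Mochizuki, *Inter-universal Teichmüller theory I*, kurims manuscript (May 2020), Def 3.1 (d) p. 62 (`[Π_{C̲_K} : Π_{X̲_K}] = 2`),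
Def 3.1 (e) pp. 62–63 (at `v̲ ∈ V̲^bad`: `Π_{X̳_v̲} ⊆ Π_{C̳_v̲} ⊆ Π_{C̲_v̲}`, `Π_v̲ := Π^tp_{X̳_v̲}`), Def 3.1 (f) p. 63 (`Π_{X̲→_K} ⊆ Π_{C̲→_K}`;
at `v̲ ∈ V̲^good`: `Π_v̲ := Π_{X̲→_v̲}`), Def 6.1 (ii)–(vii) pp. 156–159 ([IUTchI] Def 3.1 (e) p.62) [claim: Mochizuki2012, status: disputed]
(D-0012 claim key, series status DISPUTED — constructions over abc-iut-L5-t2's REAL `InitialThetaData`; nothing of the series is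
asserted, no side is taken on [IUTchIII] Cor. 3.12).

## HONESTY TAG (travels with every use of this file)
The genuine datum at a bad place is the TEMPERED `Π^tp_{X̳_v̲}` of the model `X̳_v̲` of [EtTh] Def 2.5 («extracting an `l`-th root of the
theta function», Def 3.1 (e)) — an L3/[EtTh]-side object, after-merge. This file does NOT construct it and does NOT identify anything with it.
It exhibits two PROFINITE STAND-INS inhabiting abc-iut-L5-t4's binder TYPE `BadPairAt v` (p445979; seven fields: `le`, `relIndex_eq_two`,
`le_PiCund`, `inf_le`, `le_loc`, `map_augGF`, over the decomposition group `decompAt v`):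
* **(U) «[profinite decomposition stand-in]» `badPairAtUnd v := (Π_{X̲_K} ∩ augGF⁻¹ G_v̲, Π_{C̲_K} ∩ augGF⁻¹ G_v̲)`** — BINDER-FREE; index `2`
  from `[Π_{C̲_K} : Π_{X̲_K}] = 2` (Def 3.1 (d); `piXund_relIndex_piCund`, PiAvatarGlobalInvolution) base-changed to `G_v̲` because
  `augGF(Π_{C̲_K}) ⊆ augGF(Π_{X̲_K})` (both are `G_K`). Hence `nonempty_badPairAt : ∀ v, Nonempty (D.BadPairAt v)` with NO hypothesis.
  CAVEAT (not proved here, recorded for the cert bank): its `H = Π_{X̲_v̲}` is normalised by `Π_{X_v̲}`, whose deck transformations move the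
  cusps of `X̲_K` WITHOUT fixed points, so the companion binder `LocalArrowLaw (badPairAtUnd v).H` (its (L2) sign field) is NOT expected to
  be inhabitable — (U) witnesses the TYPE `BadPairAt v` only.
* **(A) «[`X̲→`-profinite stand-in]» `badPairAtArrow hA v := (Π_{X̲→_K} ∩ augGF⁻¹ G_v̲, Π_{C̲→_K} ∩ augGF⁻¹ G_v̲)`** — the GOOD-place recipe of
  Def 3.1 (f) applied at the index `v` (binder: t1's §1 claims `hA`, for the index `2` and `Π_{C̲→_K} ∩ Π_{X̲_K} ⊆ Π_{X̲→_K}`). Its companion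
  law type IS the good-place law type, so `localGroupAt (fun v _ => badPairAtArrow hA v) v = Π_{X̲→_K} ∩ augGF⁻¹ G_v̲` UNIFORMLY in `v`, and
  **`baseKitArrowStandIn CG hS M hA hI hsign : PMBaseKit.{w} l`** := `baseKitOfTorsionMonodromy` (p446463) at `B := badPairAtArrow hA`,
  `ΛBad := localArrowLaw_good_of_torsionMonodromy …` — binders EXACTLY {`CG`, `hS`, `M : TorsionMonodromy` (NV #45), `hA`, `hI`, `hsign` (the
  Def 6.1 (iii) sign law at `Π_{X̲→_K} ∩ augGF⁻¹ G_v̲` for every index; abc-iut-L5-d5's (L2) theorem discharges it)}; with (α), (β) and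
  Prop 6.6 (ii)(iii) / 6.8 (i) / Ex 6.3 (ii) at it. The print's `𝒟_v̲` at `v̲ ∈ V̲^bad` is `ℬ^temp(X̳_v̲)⁰`, NOT `ℬ(Π_{X̲→_v̲})⁰`: (A) is a
  stand-in of the same SHAPE, never the genuine bad-place datum.
No instance, no notation; typed ≠ inhabited ≠ proved; binders ≠ facts; a stand-in inhabitant is NOT the genuine tempered datum.
-/

noncomputable section

namespace Literature.IUT.HodgeTheaters

open CategoryTheory

universe u v w

section BadPairAtStandIn

variable {F : Type u} {K : Type v} {Fbar : Type w} [Field F] [NumberField F] [Field K] [NumberField K]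
  [Algebra F K] [Field Fbar] [Algebra F Fbar] [Algebra K Fbar]
  {E : WeierstrassCurve F} [E.IsElliptic] {l : ℕ} {Pb : BadPlacePredicates K}
  (D : InitialThetaData F K Fbar E l Pb)

namespace InitialThetaData

/-! ### `[Π_{C̲_K} : Π_{X̲_K}] = 2` inside `Π_{C_F}` and its base change to a decomposition group -/

/-- `augGF(Π_{C̲_K}) ⊆ augGF(Π_{X̲_K})` — both are `G_K` (`Π_{C̲_K} ≤ Π_{C_K} ↦ G_K` by `ThetaGeometry.aug_compat`; `Π_{X̲_K} ↠ G_K` is t2's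
`galoisSubgroupOf_le_map_PiXund`). ([IUTchI] Def 3.1 (d) p.62) [claim: Mochizuki2012, status: disputed] -/
theorem map_augGF_PiCund_le : D.PiCund.map D.augGF ≤ D.PiXund.map D.augGF := by
  refine le_trans ?_ D.galoisSubgroupOf_le_map_PiXund
  rintro g ⟨y, hy, rfl⟩
  obtain ⟨z, -, rfl⟩ := hy
  rw [augGF_apply, D.geom.aug_compat]
  exact (D.geom.galKIso (D.geom.pe.E.aug z)).2

/-- **`[Π_{C̲_v̲} : Π_{X̲_v̲}] = 2`**: base change of `X̲_K → C̲_K` to any subgroup `Gv ≤ G_F` (a decomposition group) keeps the degree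
(`OrbitCat.relIndex_inf_comap_eq_two` at `[Π_{C̲_K} : Π_{X̲_K}] = 2` = `piXund_relIndex_piCund`, PiAvatarGlobalInvolution). ([IUTchI] Def 3.1 (e) p.62) [claim: Mochizuki2012, status: disputed] -/
theorem PiXund_inf_relIndex_PiCund_inf (Gv : Subgroup (Fbar ≃ₐ[F] Fbar)) :
    (D.PiXund ⊓ Gv.comap D.augGF).relIndex (D.PiCund ⊓ Gv.comap D.augGF) = 2 :=
  OrbitCat.relIndex_inf_comap_eq_two D.augGF D.PiXund_le_PiCund D.piXund_relIndex_piCund D.map_augGF_PiCund_le Gv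

/-- `Π_{C̲→_v̲} ∩ Π_{X̲_K} ⊆ Π_{X̲→_v̲}` (from t1's cartesian square `Π_{X̲→} = Π_{X̲} ∩ Π_{C̲→}`, via `not_mem_PiXund_of_mem_PiCarrow`).
([IUTchI] Def 3.1 (f) p.63) [claim: Mochizuki2012, status: disputed] -/
theorem PiCarrow_inf_inf_PiXund_le (hA : D.geom.pe.ArrowCoveringClaims) (Gv : Subgroup (Fbar ≃ₐ[F] Fbar)) :
    (D.PiCarrow ⊓ Gv.comap D.augGF) ⊓ D.PiXund ≤ D.PiXarrow ⊓ Gv.comap D.augGF := by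
  intro x hx
  obtain ⟨⟨hxC, hxG⟩, hxU⟩ := hx
  exact ⟨by_contra fun h => D.not_mem_PiXund_of_mem_PiCarrow hA hxC h hxU, hxG⟩

/-! ### Stand-in (U): the full decomposition pair `(Π_{X̲_v̲}, Π_{C̲_v̲})` — binder-free -/

/-- **Stand-in (U) «[profinite decomposition stand-in]»**: `(Π_{X̲_K} ∩ augGF⁻¹ G_v̲, Π_{C̲_K} ∩ augGF⁻¹ G_v̲)` satisfies the seven fields of
`BadPairAt v` with NO hypothesis. It is NOT the genuine `(Π_{X̳_v̲}, Π_{C̳_v̲})` (index `l` below it; tempered; [EtTh]) and its companion law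
type is not expected to be inhabitable (module docstring CAVEAT). ([IUTchI] Def 3.1 (e) p.62) [claim: Mochizuki2012, status: disputed] -/
def badPairAtUnd (v : D.IndexCopy) : D.BadPairAt v where
  H := D.PiXund ⊓ (D.decompAt v).comap D.augGF
  H' := D.PiCund ⊓ (D.decompAt v).comap D.augGF
  le := inf_le_inf_right _ D.PiXund_le_PiCund
  relIndex_eq_two := D.PiXund_inf_relIndex_PiCund_inf (D.decompAt v)
  le_PiCund := inf_le_left
  inf_le := fun _ hx => ⟨hx.2, hx.1.2⟩
  le_loc := le_rfl
  map_augGF := D.map_augGF_PiXund_inf (D.decompAt v)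

/-- `(badPairAtUnd v).H = Π_{X̲_K} ∩ augGF⁻¹ G_v̲`. ([IUTchI] Def 3.1 (e) p.62) [claim: Mochizuki2012, status: disputed] -/
@[simp] theorem badPairAtUnd_H (v : D.IndexCopy) : (D.badPairAtUnd v).H = D.PiXund ⊓ (D.decompAt v).comap D.augGF := rfl

/-- `(badPairAtUnd v).H' = Π_{C̲_K} ∩ augGF⁻¹ G_v̲`. ([IUTchI] Def 3.1 (e) p.62) [claim: Mochizuki2012, status: disputed] -/
@[simp] theorem badPairAtUnd_H' (v : D.IndexCopy) : (D.badPairAtUnd v).H' = D.PiCund ⊓ (D.decompAt v).comap D.augGF := rfl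

/-- **NV of the binder TYPE, unconditionally**: `BadPairAt v` is inhabited at every index of the genuine initial Θ-data (by stand-in (U)).
This says NOTHING about the genuine tempered datum. ([IUTchI] Def 3.1 (e) p.62) [claim: Mochizuki2012, status: disputed] -/
theorem nonempty_badPairAt (v : D.IndexCopy) : Nonempty (D.BadPairAt v) :=
  ⟨D.badPairAtUnd v⟩

/-- The bad-pair FAMILY binder `B : ∀ v ∈ V̲^bad, BadPairAt v` of `baseKit` is inhabited (stand-in (U)). ([IUTchI] Def 3.1 (e) p.62) [claim: Mochizuki2012, status: disputed] -/
theorem nonempty_badPairFamily : Nonempty (∀ v, v ∈ D.indexCopyBad → D.BadPairAt v) :=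
  ⟨fun v _ => D.badPairAtUnd v⟩

/-! ### Stand-in (A): the `X̲→`-pair `(Π_{X̲→_v̲}, Π_{C̲→_v̲})` — law-compatible -/

/-- **Stand-in (A) «[`X̲→`-profinite stand-in]»**: `(Π_{X̲→_K} ∩ augGF⁻¹ G_v̲, Π_{C̲→_K} ∩ augGF⁻¹ G_v̲)` — the good-place recipe of Def 3.1 (f)
at the index `v` — satisfies the seven fields of `BadPairAt v` under t1's §1 claims `hA` (index `2`: `exists_localInvolution`; `inf_le`: the
cartesian square). NOT the genuine `(Π_{X̳_v̲}, Π_{C̳_v̲})` of Def 3.1 (e). ([IUTchI] Def 3.1 (f) p.63) [claim: Mochizuki2012, status: disputed] -/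
def badPairAtArrow (hA : D.geom.pe.ArrowCoveringClaims) (v : D.IndexCopy) : D.BadPairAt v where
  H := D.PiXarrow ⊓ (D.decompAt v).comap D.augGF
  H' := D.PiCarrow ⊓ (D.decompAt v).comap D.augGF
  le := inf_le_inf_right _ D.PiXarrow_le_PiCarrow
  relIndex_eq_two := (D.exists_localInvolution hA (D.decompAt v)).1
  le_PiCund := inf_le_left.trans D.PiCarrow_le_PiCund
  inf_le := D.PiCarrow_inf_inf_PiXund_le hA (D.decompAt v)
  le_loc := D.PiXarrow_inf_le_PiXund_inf (D.decompAt v)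
  map_augGF := D.map_augGF_PiXarrow_inf (D.decompAt v)

variable (hA : D.geom.pe.ArrowCoveringClaims)

/-- `(badPairAtArrow hA v).H = Π_{X̲→_K} ∩ augGF⁻¹ G_v̲`. ([IUTchI] Def 3.1 (f) p.63) [claim: Mochizuki2012, status: disputed] -/
@[simp] theorem badPairAtArrow_H (v : D.IndexCopy) :
    (D.badPairAtArrow hA v).H = D.PiXarrow ⊓ (D.decompAt v).comap D.augGF := rfl

/-- `(badPairAtArrow hA v).H' = Π_{C̲→_K} ∩ augGF⁻¹ G_v̲`. ([IUTchI] Def 3.1 (f) p.63) [claim: Mochizuki2012, status: disputed] -/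
@[simp] theorem badPairAtArrow_H' (v : D.IndexCopy) :
    (D.badPairAtArrow hA v).H' = D.PiCarrow ⊓ (D.decompAt v).comap D.augGF := rfl

open Classical in
/-- **At stand-in (A) the local group is UNIFORM**: `Π_v̲ = Π_{X̲→_K} ∩ augGF⁻¹ G_v̲` at EVERY index, bad or not.
([IUTchI] Def 3.1 (f) p.63) [claim: Mochizuki2012, status: disputed] -/
theorem localGroupAt_badPairAtArrow (v : D.IndexCopy) :
    D.localGroupAt (fun v _ => D.badPairAtArrow hA v) v = D.PiXarrow ⊓ (D.decompAt v).comap D.augGF := by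
  by_cases h : v ∈ D.indexCopyBad
  · rw [D.localGroupAt_of_mem _ h]
    rfl
  · rw [D.localGroupAt_of_not_mem _ h]

/-! ### The [IUTchI] §6 base kit at stand-in (A): binders {`CG`, `hS`, `M`, `hA`, `hI`, `hsign`} -/

variable (CG : D.geom.pe.CuspGalois) (hS : D.CuspClassesNormaliserStable) [Fact l.Prime]
  (M : D.TorsionMonodromy) (hI : ∀ k ∈ D.geom.pe.inertia D.geom.pe.ε1, M.tau (D.geom.embK k) = 0)
  (hsign : ∀ v : D.IndexCopy, ∀ n : D.PiC,
    n ∈ Subgroup.normalizer ((D.PiXarrow ⊓ (D.decompAt v).comap D.augGF : Subgroup D.PiC) : Set D.PiC) →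
      ∀ hn : n ∈ Subgroup.normalizer ((D.PiXund : Subgroup D.PiC) : Set D.PiC),
        ∃ ε : ℤˣ, ∀ x, D.gChart₀Model CG (D.actF CG hS ⟨n, hn⟩ x) = ε • D.gChart₀Model CG x)

/-- **THE BASE KIT AT STAND-IN (A)** — `baseKitOfTorsionMonodromy` (p446463) with `B := badPairAtArrow hA` and the bad-index laws the
good-place laws `localArrowLaw_good_of_torsionMonodromy M hA hI (G_v̲) (hsign v)`; binders exactly `CG`, `hS`, `M`, `hA`, `hI`, `hsign`.
«[`X̲→`-profinite stand-in at `v̲ ∈ V̲^bad`]»: print's `𝒟_v̲ = ℬ^temp(X̳_v̲)⁰` there is NOT this kit's `ℬ(Π_{X̲→_v̲})⁰`.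
([IUTchI] Def 6.1 (ii)-(vii) pp.156-159) [claim: Mochizuki2012, status: disputed] -/
def baseKitArrowStandIn : PMBaseKit.{w} l :=
  D.baseKitOfTorsionMonodromy CG hS M hA hI (fun v _ => D.badPairAtArrow hA v) (fun v _ => hsign v)
    (fun v _ => D.localArrowLaw_good_of_torsionMonodromy CG hS M hA hI (D.decompAt v) (hsign v))

/-- The place kit over `V̲` at stand-in (A) (its kit is `baseKitArrowStandIn`). ([IUTchI] Def 3.1 (e) p.62) [claim: Mochizuki2012, status: disputed] -/
def placeKitArrowStandIn : PlaceKit.{w} D :=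
  haveI := M.normal_PiXund_subgroupOf_PiXK
  D.placeKit (fun v _ => D.badPairAtArrow hA v) CG hS (D.toFlStarGlobal_surjective_of_torsionMonodromy M) hA
    (D.localArrowLawFamilyOfTorsionMonodromy CG hS M hA hI (fun v _ => D.badPairAtArrow hA v) (fun v _ => hsign v)
      (fun v _ => D.localArrowLaw_good_of_torsionMonodromy CG hS M hA hI (D.decompAt v) (hsign v)))

/-- The kit of the stand-in place kit is `baseKitArrowStandIn`. ([IUTchI] Def 6.1 (ii) p.156) [claim: Mochizuki2012, status: disputed] -/
theorem placeKitArrowStandIn_kit :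
    (D.placeKitArrowStandIn hA CG hS M hI hsign).kit = D.baseKitArrowStandIn hA CG hS M hI hsign := rfl

/-- The index type of the stand-in kit is the `Type 0` copy of `V̲`. ([IUTchI] Def 3.1 (e) p.62) [claim: Mochizuki2012, status: disputed] -/
theorem baseKitArrowStandIn_V : (D.baseKitArrowStandIn hA CG hS M hI hsign).V = D.IndexCopy := rfl

/-- **(α) `PhiEllSync`** at the stand-in kit. ([IUTchI] Ex 6.3 (i) p.161) [claim: Mochizuki2012, status: disputed] -/
theorem phiEllSync_baseKitArrowStandIn : PMBaseKit.Ex63.PhiEllSync (D.baseKitArrowStandIn hA CG hS M hI hsign) :=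
  D.phiEllSync_baseKitOfTorsionMonodromy CG hS M hA hI _ _ _

/-- **(β) `NegCompatModel`** at the stand-in kit. ([IUTchI] Ex 6.3 (ii) p.161) [claim: Mochizuki2012, status: disputed] -/
theorem negCompatModel_baseKitArrowStandIn : PMBaseKit.Ex63.NegCompatModel (D.baseKitArrowStandIn hA CG hS M hI hsign) :=
  D.negCompatModel_baseKitOfTorsionMonodromy CG hS M hA hI _ _ _

/-- **[IUTchI] Prop 6.6 (ii)** at the stand-in kit. ([IUTchI] Prop 6.6 (ii) p.165) [claim: Mochizuki2012, status: disputed] -/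
theorem isoTorsor_thetaEllBridge_baseKitArrowStandIn (B₁ B₂ : (D.baseKitArrowStandIn hA CG hS M hI hsign).DThetaEllBridge) :
    PMBaseKit.DThetaEllBridge.IsoTorsor B₁ B₂ :=
  PMBaseKit.DThetaEllBridge.isoTorsor_of_negCompatModel (D.negCompatModel_baseKitArrowStandIn hA CG hS M hI hsign) B₁ B₂

/-- **[IUTchI] Prop 6.6 (iii)** at the stand-in kit. ([IUTchI] Prop 6.6 (iii) p.165) [claim: Mochizuki2012, status: disputed] -/
theorem isoTorsor_thetaPMEllHT_baseKitArrowStandIn (H₁ H₂ : (D.baseKitArrowStandIn hA CG hS M hI hsign).DThetaPMEllHT) :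
    PMBaseKit.DThetaPMEllHT.IsoTorsor H₁ H₂ :=
  PMBaseKit.DThetaPMEllHT.isoTorsor_of_negCompatModel (D.negCompatModel_baseKitArrowStandIn hA CG hS M hI hsign) H₁ H₂

/-- **[IUTchI] Prop 6.8 (i)** at the stand-in kit. ([IUTchI] Prop 6.8 (i) p.167) [claim: Mochizuki2012, status: disputed] -/
theorem ellBridgeSymmetry_baseKitArrowStandIn (H : (D.baseKitArrowStandIn hA CG hS M hI hsign).DThetaPMEllHT) :
    PMBaseKit.DThetaPMEllHT.EllBridgeSymmetry H :=
  PMBaseKit.DThetaPMEllHT.ellBridgeSymmetry_of_negCompatModel (D.negCompatModel_baseKitArrowStandIn hA CG hS M hI hsign) H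

/-- **[IUTchI] Ex 6.3 (ii)** (negative `γ`) at the stand-in kit. ([IUTchI] Ex 6.3 (ii) p.161) [claim: Mochizuki2012, status: disputed] -/
theorem equivariant_baseKitArrowStandIn {γ : FlPM l} (hγ : γ.IsNegative) :
    PMBaseKit.Ex63.Equivariant (D.baseKitArrowStandIn hA CG hS M hI hsign) γ :=
  (D.negCompatModel_baseKitArrowStandIn hA CG hS M hI hsign).equivariant hγ

end InitialThetaData

end BadPairAtStandIn

end Literature.IUT.HodgeTheaters
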